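import Mathlib.Analysis.Calculus.ParametricIntervalIntegral
import Mathlib.Analysis.SpecialFunctions.Pow.Deriv
import Literature.Probability.RandomPlanarGeometry.EllipticKBasic
import HarnessLib

/-!
# Differentiability of the complete elliptic integral `K(m)` in the parameter

Topic `Literature/Analysis/SpecialFunctions`. For the tree's `ellipticK m = ∫₀¹ dt/√((1-t²)(1-m t²))`
(parameter convention) we differentiate under the integral sign on `(-∞, 1)`:

* `hasDerivAt_ellIntegrand_param` — for `|t| < 1`, `x < 1`:
  `∂/∂x [1/√((1-t²)(1-x t²))] = (t²/2)(1-t²)^{-1/2}(1-x t²)^{-3/2}`;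
* `hasDerivAt_ellipticK` — **`K` is differentiable at every `m < 1` with
  `K′(m) = ∫₀¹ (t²/2)(1-t²)^{-1/2}(1-m t²)^{-3/2} dt`** (dominated differentiation,
  `intervalIntegral.hasDerivAt_integral_of_dominated_loc_of_deriv_le`, domination by
  `C(1-t)^{-1/2}` locally uniformly in `m`), and the derivative integrand is integrable;
* `differentiableAt_ellipticK`, `deriv_ellipticK`, `deriv_ellipticK_pos` — `K′(m) > 0`.

The classical closed form of this derivative is `dK/dm = (E(m) - (1-m)K(m))/(2m(1-m))`
(Gradshteyn–Ryzhik 8.123.2 in the modulus `k`, `m = k²`); `E` is not needed here and is not used.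

## References
* [GradshteynRyzhik2015] I. S. Gradshteyn, I. M. Ryzhik, *Table of Integrals, Series, and Products*,
  8th ed. (2015), 8.123 (derivatives of the complete elliptic integrals), 8.112.1 (definition of `K`).
* [AbramowitzStegun1964] M. Abramowitz, I. Stegun, *Handbook of Mathematical Functions*, 17.3.1, 17.3.11.
-/

noncomputable section

open Real _root_.MeasureTheory _root_.Set _root_.Filter Metric
open scoped _root_.Topology
open Literature.Probability.RandomPlanarGeometry

namespace Literature.Analysis.SpecialFunctions

/-- **Parameter derivative of the elliptic integrand**: for `|t| < 1` and `x < 1`,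
`∂/∂x [1/√((1-t²)(1-x t²))] = (t²/2)·(1-t²)^{-1/2}·(1-x t²)^{-3/2}`.
[cite: GradshteynRyzhik2015, 8.123] -/
theorem hasDerivAt_ellIntegrand_param {x t : ℝ} (hx : x < 1) (ht : t ∈ Ioo (-1 : ℝ) 1) :
    HasDerivAt (fun y => ellIntegrand y t)
      (t ^ 2 / 2 * ((1 - t ^ 2) ^ (-(1 / 2 : ℝ)) * (1 - x * t ^ 2) ^ (-(3 / 2 : ℝ)))) x := by
  have heq : (fun y => (1 - t ^ 2) ^ (-(1 / 2 : ℝ)) * (1 - y * t ^ 2) ^ (-(1 / 2 : ℝ)))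
      =ᶠ[𝓝 x] fun y => ellIntegrand y t := by
    filter_upwards [Iio_mem_nhds hx] with y hy using (ellIntegrand_eq_rpow hy ht).symm
  refine HasDerivAt.congr_of_eventuallyEq ?_ heq.symm
  have hpos : 0 < 1 - x * t ^ 2 := one_sub_mul_sq_pos hx ht
  have h1 : HasDerivAt (fun y => 1 - y * t ^ 2) (-(t ^ 2)) x := by
    simpa using ((hasDerivAt_id x).mul_const (t ^ 2)).const_sub 1
  have h2 := h1.rpow_const (p := -(1 / 2 : ℝ)) (Or.inl hpos.ne')
  have h3 := h2.const_mul ((1 - t ^ 2) ^ (-(1 / 2 : ℝ)))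
  refine h3.congr_deriv ?_
  rw [show (-(1 / 2 : ℝ) - 1) = -(3 / 2 : ℝ) by norm_num]
  ring

/-- Lower bound of `1 - x t²` uniformly in `x < m₁`, `t ∈ [0,1]`: `min 1 (1-m₁) ≤ 1 - x t²`. [folklore] -/
private theorem min_le_one_sub_mul_sq {x m₁ t : ℝ} (hx : x < m₁) (ht0 : 0 ≤ t) (ht1 : t ≤ 1) :
    min 1 (1 - m₁) ≤ 1 - x * t ^ 2 := by
  have ht2 : t ^ 2 ≤ 1 := by nlinarith
  have ht2' : 0 ≤ t ^ 2 := sq_nonneg t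
  rcases le_or_gt 0 x with hx0 | hx0
  · have : x * t ^ 2 ≤ m₁ := by nlinarith
    exact (min_le_right _ _).trans (by linarith)
  · have : x * t ^ 2 ≤ 0 := by nlinarith
    exact (min_le_left _ _).trans (by linarith)

/-- **`K` is differentiable on `(-∞, 1)`**, with
`K′(m) = ∫₀¹ (t²/2)(1-t²)^{-1/2}(1-m t²)^{-3/2} dt`, and this integrand is integrable on `[0,1]`
(differentiation under the integral sign, dominated locally uniformly in `m` by `C(1-t)^{-1/2}`).
[cite: GradshteynRyzhik2015, 8.123] -/
theorem hasDerivAt_ellipticK {m : ℝ} (hm : m < 1) :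
    IntervalIntegrable (fun t : ℝ => t ^ 2 / 2 * ((1 - t ^ 2) ^ (-(1 / 2 : ℝ)) * (1 - m * t ^ 2) ^ (-(3 / 2 : ℝ))))
        volume 0 1 ∧
      HasDerivAt ellipticK
        (∫ t in (0 : ℝ)..1, t ^ 2 / 2 * ((1 - t ^ 2) ^ (-(1 / 2 : ℝ)) * (1 - m * t ^ 2) ^ (-(3 / 2 : ℝ)))) m := by
  -- a neighbourhood `Iio m₁` of `m` inside `(-∞, 1)` and the uniform constant `c₀`
  set m₁ : ℝ := (m + 1) / 2 with hm₁_def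
  have hmm₁ : m < m₁ := by rw [hm₁_def]; linarith
  have hm₁ : m₁ < 1 := by rw [hm₁_def]; linarith
  set c₀ : ℝ := min 1 (1 - m₁) with hc₀_def
  have hc₀ : 0 < c₀ := lt_min one_pos (by linarith)
  set C : ℝ := 1 / 2 * c₀ ^ (-(3 / 2 : ℝ)) with hC_def
  have hfun : ellipticK = fun x => ∫ t in (0 : ℝ)..1, ellIntegrand x t := funext ellipticK_eq
  rw [hfun]
  refine intervalIntegral.hasDerivAt_integral_of_dominated_loc_of_deriv_le
    (F := fun x t => ellIntegrand x t)
    (F' := fun x t => t ^ 2 / 2 * ((1 - t ^ 2) ^ (-(1 / 2 : ℝ)) * (1 - x * t ^ 2) ^ (-(3 / 2 : ℝ))))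
    (bound := fun t => C * (1 - t) ^ (-(1 / 2 : ℝ)))
    (Iio_mem_nhds hmm₁) ?_ (intervalIntegrable_ellIntegrand_of_lt_one hm) ?_ ?_
    (intervalIntegrable_const_mul_one_sub_rpow C) ?_
  · -- measurability of `F x`
    exact Eventually.of_forall fun x => (measurable_ellIntegrand x).aestronglyMeasurable
  · -- measurability of `F' m`
    refine Measurable.aestronglyMeasurable ?_
    fun_prop
  · -- domination on `Ι 0 1 = Ioc 0 1`, uniformly in `x < m₁`
    refine Eventually.of_forall fun t ht x hx => ?_
    rw [uIoc_of_le zero_le_one] at ht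
    have hx : x < m₁ := hx
    rcases lt_or_eq_of_le ht.2 with h1 | h1
    · have hpos : 0 < 1 - x * t ^ 2 := lt_of_lt_of_le hc₀ (min_le_one_sub_mul_sq hx ht.1.le ht.2)
      have h1t : 0 < 1 - t := by linarith
      have h1t2 : 0 < 1 - t ^ 2 := by nlinarith [ht.1]
      have hnn : 0 ≤ t ^ 2 / 2 * ((1 - t ^ 2) ^ (-(1 / 2 : ℝ)) * (1 - x * t ^ 2) ^ (-(3 / 2 : ℝ))) := by
        positivity
      rw [Real.norm_of_nonneg hnn]
      -- `(1 - x t²)^{-3/2} ≤ c₀^{-3/2}`, `(1-t²)^{-1/2} ≤ (1-t)^{-1/2}`, `t²/2 ≤ 1/2`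
      have hA : (1 - x * t ^ 2) ^ (-(3 / 2 : ℝ)) ≤ c₀ ^ (-(3 / 2 : ℝ)) :=
        Real.rpow_le_rpow_of_nonpos hc₀ (min_le_one_sub_mul_sq hx ht.1.le ht.2) (by norm_num)
      have hB : (1 - t ^ 2) ^ (-(1 / 2 : ℝ)) ≤ (1 - t) ^ (-(1 / 2 : ℝ)) :=
        Real.rpow_le_rpow_of_nonpos h1t (by nlinarith [ht.1]) (by norm_num)
      have hc : t ^ 2 / 2 ≤ 1 / 2 := by nlinarith
      have hA0 : 0 ≤ (1 - x * t ^ 2) ^ (-(3 / 2 : ℝ)) := by positivity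
      have hB0 : 0 ≤ (1 - t ^ 2) ^ (-(1 / 2 : ℝ)) := by positivity
      have hBt : 0 ≤ (1 - t) ^ (-(1 / 2 : ℝ)) := by positivity
      have hc0 : 0 ≤ c₀ ^ (-(3 / 2 : ℝ)) := by positivity
      calc t ^ 2 / 2 * ((1 - t ^ 2) ^ (-(1 / 2 : ℝ)) * (1 - x * t ^ 2) ^ (-(3 / 2 : ℝ)))
          ≤ 1 / 2 * ((1 - t) ^ (-(1 / 2 : ℝ)) * c₀ ^ (-(3 / 2 : ℝ))) := by
            gcongr
        _ = C * (1 - t) ^ (-(1 / 2 : ℝ)) := by rw [hC_def]; ring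
    · -- `t = 1`: both sides vanish (junk value `0 ^ (-1/2) = 0`)
      subst h1
      have h0 : (1 - (1 : ℝ) ^ 2) ^ (-(1 / 2 : ℝ)) = 0 := by norm_num [Real.zero_rpow]
      have h0' : (1 - (1 : ℝ)) ^ (-(1 / 2 : ℝ)) = 0 := by norm_num [Real.zero_rpow]
      rw [h0, h0']
      simp
  · -- pointwise differentiability in the parameter
    refine Eventually.of_forall fun t ht x hx => ?_
    rw [uIoc_of_le zero_le_one] at ht
    have hx1 : x < 1 := lt_trans hx hm₁
    rcases lt_or_eq_of_le ht.2 with h1 | h1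
    · exact hasDerivAt_ellIntegrand_param hx1 ⟨by linarith [ht.1], h1⟩
    · -- `t = 1`: `y ↦ ellIntegrand y 1 = 0` is constant and `F' x 1 = 0`
      subst h1
      have h0 : (1 - (1 : ℝ) ^ 2) ^ (-(1 / 2 : ℝ)) = 0 := by norm_num [Real.zero_rpow]
      have hconst : (fun y : ℝ => ellIntegrand y 1) = fun _ => 0 := by
        funext y; simp [ellIntegrand]
      rw [hconst, h0]
      simpa using hasDerivAt_const x (0 : ℝ)

/-- `K` is differentiable at every `m < 1`. [cite: GradshteynRyzhik2015, 8.123] -/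
theorem differentiableAt_ellipticK {m : ℝ} (hm : m < 1) : DifferentiableAt ℝ ellipticK m :=
  (hasDerivAt_ellipticK hm).2.differentiableAt

/-- **`K′(m) = ∫₀¹ (t²/2)(1-t²)^{-1/2}(1-m t²)^{-3/2} dt`** for `m < 1`. [cite: GradshteynRyzhik2015, 8.123] -/
theorem deriv_ellipticK {m : ℝ} (hm : m < 1) :
    deriv ellipticK m =
      ∫ t in (0 : ℝ)..1, t ^ 2 / 2 * ((1 - t ^ 2) ^ (-(1 / 2 : ℝ)) * (1 - m * t ^ 2) ^ (-(3 / 2 : ℝ))) :=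
  (hasDerivAt_ellipticK hm).2.deriv

/-- **`K′(m) > 0`** for `m < 1` (the derivative integrand is positive on `(0,1)`).
[cite: GradshteynRyzhik2015, 8.123] -/
theorem deriv_ellipticK_pos {m : ℝ} (hm : m < 1) : 0 < deriv ellipticK m := by
  rw [deriv_ellipticK hm]
  refine intervalIntegral.intervalIntegral_pos_of_pos_on (hasDerivAt_ellipticK hm).1 ?_ zero_lt_one
  intro t ht
  have h1 : 0 < 1 - t ^ 2 := by nlinarith [ht.1, ht.2]
  have h2 : 0 < 1 - m * t ^ 2 := one_sub_mul_sq_pos hm ⟨by linarith [ht.1], ht.2⟩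
  have h3 : 0 < t ^ 2 / 2 := by have := ht.1; positivity
  positivity

end Literature.Analysis.SpecialFunctions

end
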